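import Literature.NumberTheory.Automorphic.ArchCartanStableSum      -- ★ part 1: `flipSet`, `stableSum`, `continuous_archRH`, `archRH_eq_zero_of_apply_eq_zero`
import Mathlib.Topology.ExtendFrom
import HarnessLib

/-!
# The wall extension `bzExtend S F = 𝟙_{InRegS S} · extendFrom (RegS S) F` and its transported symmetries — the GROUP-FREE half of `Ψfam`, part 2 of 2
# (Bouaziz 1994 §3.1 (I₂) p. 579, §6.2 p. 591; Shelstad 1979 §4 pp. 22–24; Harish-Chandra's `F_f^A` across the real walls)

Topic `NumberTheory/Automorphic`; namespace `Literature.NumberTheory.Automorphic.ArchCartan`.  Definitions WITH BODIES and theorems only (no instance, no notation, no axiom,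
no named fact, no `sorry`).  Cell `pub/hodgecm-mathlib`, line LH3 (closer stub `stub_N9`, crux H413 = `stmt-HodgeConjecture-24833`); organ **(D2-P3a)** part 2 (LH3-p01 (g3),
2026-09-02; PACK-SPEC v1 §2 `extendFrom` DECISION).  PART 3 proper then reads `stOrbFamH νH fH S := bzExtend S (fun c => archRH S c * stableSum S (chartOrbH νH S fH) c)`.

DESIGN (SEAM RULING 05:53:17Z).  `bzExtend S F c := if c ∈ RegS S then F c else (InRegS S).indicator (extendFrom (RegS S) F) c`: on the regular set it is LITERALLY `F` (`bzExtend_of_mem_regS`, no continuity binder); at a REAL wall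
`x_w = 0` (in `InRegS S ∖ RegS S`) it is the limit of `F` from the regular set WHEN IT EXISTS (for `F = R_S · Φ^st` of a test function it does — Harish-Chandra's `F_f^A(1)`,
Bouaziz's (I₂); that existence is the letter's clause, NOT assumed here); on the imaginary walls it is `0` (values there are never read).  KEY POINT: the symmetry clauses (P), (W)
of ★ `ArchBouazizSpaceH` hold for `bzExtend S F` WITHOUT any limit existing — `extendFrom A F x` depends only on the filter `(𝓝[A] x).map F` (`extendFrom_eq_of_map_nhdsWithin_eq`:
`limUnder` is `Classical.epsilon` of «is a limit of that filter», the `Nonempty` default being proof-irrelevant), so every homeomorphism of the coordinate space preserving `RegS S`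
and `F|RegS S` transports it (`extendFrom_apply_homeomorph`): the angle shifts (P) and `x_w ↦ −x_w` (W-real); and the division-free FLIP clause (W-flip) is trivial off `RegS S`
(imaginary wall: both sides `0`; real wall: `R_S` vanishes at `c` AND at `flipAt w c`).
HEADS: `extendFrom_eq_of_map_nhdsWithin_eq`, `extendFrom_apply_homeomorph` (generic); `bzExtend_of_mem_regS`, `bzExtend_of_not_mem_inRegS`, `bzExtend_add_angleShift`,
`bzExtend_negXAt`, `bzExtend_flipAt_mul_archRH`; the packaged symmetries of `bzExtend S (R_S • stableSum S Φ)` from hypotheses on `Φ|RegS S` only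
(`bzExtend_normStableSum_add_angleShift ∕ _negXAt ∕ _flipAt_mul_archRH`) — what PART 3 feeds into ★ `ArchBzPeriodic` ∕ ★ `ArchBzWeyl`.
HONEST LABEL: HC_CM is proved only modulo the 7 printed citations (2 remaining: hLiu418 = stmt-HodgeConjecture-24832, h413 = stmt-HodgeConjecture-24833) until rung 0 closes;
coordinate bookkeeping, pays nothing by itself.

## References
* [Bouaziz1994IntegralesOrbitales] A. Bouaziz, *Intégrales orbitales sur les groupes de Lie réductifs*, Ann. Sci. ÉNS 27 (1994) 573–609, §3.1 p. 579 ((I₂): `b_Ψ φ` extends `C^∞`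
  across `H_{Ψ-reg}`), §6.2 p. 591 (`T^st_{in-reg}`).
* [Shelstad1979] D. Shelstad, *Characters and inner forms of a quasi-split group over ℝ*, Compositio Math. 39 (1979), §4 pp. 22–24 ((I)–(III), `Φ^{T,1}_f`).
* [Rogawski1990] J. D. Rogawski, *Automorphic Representations of Unitary Groups in Three Variables*, Ann. of Math. Stud. 123 (1990), §4.1 (4.1.1) p. 39–40.
-/

set_option autoImplicit false

noncomputable section

open Filter Topology Complex Set Function Real

namespace Literature.NumberTheory.Automorphic.ArchCartan

variable {W : Type*}

/-! ## §1 `extendFrom` is transported by homeomorphisms (no limit needs to exist) -/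

section Extend

variable {X Y : Type*} [TopologicalSpace X] [TopologicalSpace Y]

/-- **`extendFrom A F x` depends only on the filter `(𝓝[A] x).map F`** (it is `Classical.epsilon` of «`· ` is a limit of that filter»; the `Nonempty` default is proof-irrelevant).
[cite: Bouaziz1994IntegralesOrbitales, §3.1 p. 579] -/
theorem extendFrom_eq_of_map_nhdsWithin_eq {A : Set X} {F : X → Y} {x x' : X} (h : (𝓝[A] x).map F = (𝓝[A] x').map F) :
    extendFrom A F x = extendFrom A F x' := by
  unfold extendFrom Filter.limUnder
  rw [h]

/-- **A homeomorphism of `X` preserving `A` and `F|_A` transports `extendFrom A F`** — at EVERY point, whether or not the limit exists there.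
[cite: Bouaziz1994IntegralesOrbitales, §3.1 p. 579] -/
theorem extendFrom_apply_homeomorph (φ : X ≃ₜ X) {A : Set X} (hA : ∀ x, φ x ∈ A ↔ x ∈ A) {F : X → Y} (hF : ∀ a ∈ A, F (φ a) = F a) (x : X) :
    extendFrom A F (φ x) = extendFrom A F x := by
  have himage : φ '' A = A := by
    ext y
    constructor
    · rintro ⟨a, ha, rfl⟩
      exact (hA a).2 ha
    · intro hy
      exact ⟨φ.symm y, (hA _).1 (by rwa [φ.apply_symm_apply]), φ.apply_symm_apply y⟩
  have hmap : map φ (𝓝[A] x) = 𝓝[A] (φ x) := by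
    rw [φ.isEmbedding.map_nhdsWithin_eq, himage]
  apply extendFrom_eq_of_map_nhdsWithin_eq
  rw [← hmap, Filter.map_map]
  exact Filter.map_congr (eventually_nhdsWithin_of_forall fun a ha => hF a ha)

end Extend

/-! ## §2 The wall extension `bzExtend` and its symmetries (SEAM RULING 2026-09-02T05:53:17Z: LITERAL on `RegS S`) -/

section BzExtend

variable [Fintype W] [DecidableEq W]

open Classical in
/-- **`bzExtend S F`** — the family member on the chart `S` attached to a function `F` given on the regular set (LH3-plan (g2) SEAM RULING (a), 2026-09-02T05:53:17Z):
LITERALLY `F c` on `RegS S` (no continuity needed to read it there — O-READ ∕ (CUR) evaluate at regular chart points); on the REAL walls `x_w = 0` (`InRegS S ∖ RegS S`) the extension of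
`F` from `RegS S` (Mathlib `extendFrom`: the limit along `𝓝[RegS S]` where it exists — Harish-Chandra's `F_f^A(1)`, Bouaziz's (I₂); existence is the letter's clause, not assumed);
`0` outside Bouaziz's `T_{in-reg}` = `InRegS S` (the imaginary walls, where the jumps live and values are never read).
[cite: Bouaziz1994IntegralesOrbitales, §3.1 p. 579; §6.2 p. 591] [cite: Shelstad1979, §4 p. 24] -/
def bzExtend (S : Finset W) (F : (W → Fin 3 → ℝ) → ℂ) : (W → Fin 3 → ℝ) → ℂ :=
  fun c => if c ∈ RegS S then F c else (InRegS S).indicator (extendFrom (RegS S) F) c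

omit [Fintype W] [DecidableEq W] in
/-- **On the regular set the family member IS `F`, literally.** [cite: Bouaziz1994IntegralesOrbitales, §3.1 p. 579] -/
theorem bzExtend_of_mem_regS (S : Finset W) (F : (W → Fin 3 → ℝ) → ℂ) {c : W → Fin 3 → ℝ} (hc : c ∈ RegS S) : bzExtend S F c = F c := by
  unfold bzExtend
  rw [if_pos hc]

omit [Fintype W] [DecidableEq W] in
/-- `bzExtend S F` and `F` agree on `RegS S`. [cite: Bouaziz1994IntegralesOrbitales, §3.1 p. 579] -/
theorem bzExtend_eqOn_regS (S : Finset W) (F : (W → Fin 3 → ℝ) → ℂ) : EqOn (bzExtend S F) F (RegS S) :=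
  fun _ hc => bzExtend_of_mem_regS S F hc

omit [Fintype W] [DecidableEq W] in
/-- On a real wall (in `InRegS S`, off `RegS S`) the family member is the extension `extendFrom (RegS S) F`. [cite: Bouaziz1994IntegralesOrbitales, §3.1 p. 579] -/
theorem bzExtend_of_mem_inRegS_of_not_mem_regS (S : Finset W) (F : (W → Fin 3 → ℝ) → ℂ) {c : W → Fin 3 → ℝ} (h1 : c ∈ InRegS S) (h2 : c ∉ RegS S) :
    bzExtend S F c = extendFrom (RegS S) F c := by
  unfold bzExtend
  rw [if_neg h2, Set.indicator_of_mem h1]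

omit [Fintype W] [DecidableEq W] in
/-- Off `InRegS S` (imaginary walls) the family member is `0`. [cite: Bouaziz1994IntegralesOrbitales, §6.2 p. 591] -/
theorem bzExtend_of_not_mem_inRegS (S : Finset W) (F : (W → Fin 3 → ℝ) → ℂ) {c : W → Fin 3 → ℝ} (h : c ∉ InRegS S) : bzExtend S F c = 0 := by
  unfold bzExtend
  rw [if_neg (fun h' => h (regS_subset_inRegS S h')), Set.indicator_of_notMem h]

omit [Fintype W] [DecidableEq W] in
/-- **TRANSPORT PRINCIPLE**: a homeomorphism of the coordinate space preserving `RegS S`, `InRegS S` and `F` on `RegS S` preserves `bzExtend S F` at EVERY point (regular: literally;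
real wall: ★ `extendFrom_apply_homeomorph`, no limit needed; imaginary wall: `0 = 0`). [cite: Bouaziz1994IntegralesOrbitales, §3.1 p. 579] [cite: Shelstad1979, §4 p. 22] -/
theorem bzExtend_apply_homeomorph (S : Finset W) (F : (W → Fin 3 → ℝ) → ℂ) (φ : (W → Fin 3 → ℝ) ≃ₜ (W → Fin 3 → ℝ))
    (hR : ∀ x, φ x ∈ RegS S ↔ x ∈ RegS S) (hI : ∀ x, φ x ∈ InRegS S ↔ x ∈ InRegS S) (hF : ∀ a ∈ RegS S, F (φ a) = F a) (c : W → Fin 3 → ℝ) :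
    bzExtend S F (φ c) = bzExtend S F c := by
  by_cases hcr : c ∈ RegS S
  · rw [bzExtend_of_mem_regS S F hcr, bzExtend_of_mem_regS S F ((hR c).2 hcr), hF c hcr]
  · by_cases hc : c ∈ InRegS S
    · rw [bzExtend_of_mem_inRegS_of_not_mem_regS S F hc hcr,
        bzExtend_of_mem_inRegS_of_not_mem_regS S F ((hI c).2 hc) (fun h => hcr ((hR c).1 h))]
      exact extendFrom_apply_homeomorph φ hR hF c
    · rw [bzExtend_of_not_mem_inRegS S F hc, bzExtend_of_not_mem_inRegS S F (fun h => hc ((hI c).1 h))]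

omit [Fintype W] in
/-- `angleShift w i (−k) = −angleShift w i k`. [cite: Shelstad1979, §4 p. 22] -/
theorem angleShift_neg (w : W) (i : Fin 3) (k : ℤ) : angleShift w i (-k) = -angleShift w i k := by
  unfold angleShift
  rw [← Pi.single_neg, ← Pi.single_neg]
  congr 2
  push_cast
  ring

omit [Fintype W] in
/-- **(P) TRANSPORT**: if `F` is periodic on `RegS S` in an angle slot, so is `bzExtend S F` — EVERYWHERE. [cite: Shelstad1979, §4 p. 22] [cite: Bouaziz1994IntegralesOrbitales, §3.1 p. 579] -/
theorem bzExtend_add_angleShift (S : Finset W) (F : (W → Fin 3 → ℝ) → ℂ) {w : W} {i : Fin 3} (h : w ∉ S ∨ i ≠ 0) (k : ℤ)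
    (hF : ∀ c ∈ RegS S, F (c + angleShift w i k) = F c) (c : W → Fin 3 → ℝ) :
    bzExtend S F (c + angleShift w i k) = bzExtend S F c := by
  have key := bzExtend_apply_homeomorph S F (Homeomorph.addRight (angleShift w i k))
    (fun x => add_angleShift_mem_regS_iff S x h k) (fun x => add_angleShift_mem_inRegS_iff S x w i k) hF c
  simpa only [Homeomorph.coe_addRight] using key

/-- `negXAt w` as a homeomorphism of the coordinate space (an involution). [cite: Shelstad1979, §4 p. 23] -/
def negXHomeomorph (w : W) : (W → Fin 3 → ℝ) ≃ₜ (W → Fin 3 → ℝ) where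
  toFun := negXAt w
  invFun := negXAt w
  left_inv := negXAt_negXAt w
  right_inv := negXAt_negXAt w
  continuous_toFun := continuous_negXAt w
  continuous_invFun := continuous_negXAt w

/-- `negXHomeomorph w` acts as `negXAt w`. [cite: Shelstad1979, §4 p. 23] -/
@[simp] theorem negXHomeomorph_apply (w : W) (c : W → Fin 3 → ℝ) : negXHomeomorph w c = negXAt w c := rfl

/-- **(W)-REAL TRANSPORT**: if `F` is even under `x_w ↦ −x_w` on `RegS S` (`w ∈ S`), so is `bzExtend S F` — everywhere. [cite: Shelstad1979, §4 p. 23] -/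
theorem bzExtend_negXAt (S : Finset W) (F : (W → Fin 3 → ℝ) → ℂ) {w : W} (hw : w ∈ S) (hF : ∀ c ∈ RegS S, F (negXAt w c) = F c) (c : W → Fin 3 → ℝ) :
    bzExtend S F (negXAt w c) = bzExtend S F c :=
  bzExtend_apply_homeomorph S F (negXHomeomorph w) (fun x => negXAt_mem_regS_iff S hw x) (fun x => negXAt_mem_inRegS_iff S hw x) hF c

/-- **(W)-FLIP, DIVISION-FREE**: for `F = R_S · G` with `G` flip-invariant on `RegS S` and a compact place `w ∉ S`,
`bzExtend S F (flipAt w c) · R_S(c) = R_S(flipAt w c) · bzExtend S F c` at EVERY `c` — on `RegS S` by the flip character of `R_S` (the values are literal there), on the real walls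
because `R_S` vanishes at `c` AND at `flipAt w c`, on the imaginary walls because `bzExtend` does.  No continuity and no limit is needed. [cite: Shelstad1979, §4 p. 23]
[cite: Bouaziz1994IntegralesOrbitales, §6.2 p. 591] -/
theorem bzExtend_flipAt_mul_archRH (S : Finset W) {G : (W → Fin 3 → ℝ) → ℂ} {w : W} (hw : w ∉ S) (hG : ∀ c ∈ RegS S, G (flipAt w c) = G c)
    (c : W → Fin 3 → ℝ) :
    bzExtend S (fun c => archRH S c * G c) (flipAt w c) * archRH S c = archRH S (flipAt w c) * bzExtend S (fun c => archRH S c * G c) c := by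
  by_cases hc : c ∈ InRegS S
  · by_cases hcr : c ∈ RegS S
    · -- regular point: both values are literal
      have hcr' : flipAt w c ∈ RegS S := (flipAt_mem_regS_iff S hw c).2 hcr
      rw [bzExtend_of_mem_regS S _ hcr', bzExtend_of_mem_regS S _ hcr, hG c hcr]
      ring
    · -- real wall: `R_S` vanishes at `c` and at `flipAt w c`
      obtain ⟨w', hw'S, hx⟩ := exists_apply_eq_zero_of_mem_inRegS_of_not_mem_regS S hc hcr
      have hne : w' ≠ w := fun h => hw (h ▸ hw'S)
      have hx' : (flipAt w c) w' 0 = 0 := by rw [flipAt_apply_of_ne hne, hx]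
      rw [archRH_eq_zero_of_apply_eq_zero S hw'S hx, archRH_eq_zero_of_apply_eq_zero S hw'S hx', mul_zero, zero_mul]
  · -- imaginary wall: `bzExtend` vanishes at `c` and at `flipAt w c`
    rw [bzExtend_of_not_mem_inRegS S _ hc, bzExtend_of_not_mem_inRegS S _ (fun h' => hc ((flipAt_mem_inRegS_iff S w c).1 h')), zero_mul, mul_zero]

/-! ### The packaged symmetries of `bzExtend S (R_S • stableSum S Φ)` from chart-level hypotheses on `Φ|RegS` -/

/-- **(P) for the normalised stable family**: angle-periodicity of `Φ` on `RegS S` (all angle slots) ⇒ periodicity of `bzExtend S (R_S · stableSum S Φ)` everywhere.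
[cite: Shelstad1979, §4 p. 22] -/
theorem bzExtend_normStableSum_add_angleShift (S : Finset W) {Φ : (W → Fin 3 → ℝ) → ℂ}
    (hΦ : ∀ c ∈ RegS S, ∀ (w : W) (i : Fin 3) (k : ℤ), (w ∉ S ∨ i ≠ 0) → Φ (c + angleShift w i k) = Φ c)
    {w : W} {i : Fin 3} (h : w ∉ S ∨ i ≠ 0) (k : ℤ) (c : W → Fin 3 → ℝ) :
    bzExtend S (fun c => archRH S c * stableSum S Φ c) (c + angleShift w i k) = bzExtend S (fun c => archRH S c * stableSum S Φ c) c :=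
  bzExtend_add_angleShift S _ h k (fun c' hc' => by rw [archRH_add_angleShift S c' h k, stableSum_add_angleShift S hΦ hc' h k]) c

/-- **(W)-real for the normalised stable family**: evenness of `Φ` under `x_w ↦ −x_w` on `RegS S` (`w ∈ S`) ⇒ evenness of `bzExtend S (R_S · stableSum S Φ)` everywhere
(`R_S` is even there, ★ `archRH_negXAt`). [cite: Shelstad1979, §4 p. 23] -/
theorem bzExtend_normStableSum_negXAt (S : Finset W) {Φ : (W → Fin 3 → ℝ) → ℂ} {w : W} (hw : w ∈ S) (hΦ : ∀ c ∈ RegS S, Φ (negXAt w c) = Φ c)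
    (c : W → Fin 3 → ℝ) :
    bzExtend S (fun c => archRH S c * stableSum S Φ c) (negXAt w c) = bzExtend S (fun c => archRH S c * stableSum S Φ c) c :=
  bzExtend_negXAt S _ hw (fun c' hc' => by rw [archRH_negXAt S hw c', stableSum_negXAt S hw hΦ hc']) c

/-- **(W)-flip for the normalised stable family, UNCONDITIONALLY**: the division-free flip relation for `bzExtend S (R_S · stableSum S Φ)` at every compact place `w ∉ S` and EVERY `c`,
for EVERY chart functional `Φ` (the stable sum is flip-invariant by itself, ★ `stableSum_flipAt`). [cite: Shelstad1979, §4 p. 23] [cite: Rogawski1990, §4.1 p. 40] -/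
theorem bzExtend_normStableSum_flipAt_mul_archRH (S : Finset W) (Φ : (W → Fin 3 → ℝ) → ℂ) {w : W} (hw : w ∉ S) (c : W → Fin 3 → ℝ) :
    bzExtend S (fun c => archRH S c * stableSum S Φ c) (flipAt w c) * archRH S c =
      archRH S (flipAt w c) * bzExtend S (fun c => archRH S c * stableSum S Φ c) c :=
  bzExtend_flipAt_mul_archRH S hw (fun c' _ => stableSum_flipAt S Φ hw c') c

end BzExtend

end Literature.NumberTheory.Automorphic.ArchCartan

end
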